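import Mathlib
import HarnessLib
import HarnessLib.Audit
import Summits.NavierStokesRegularity.Statement
import Literature.Analysis.FluidPDE.SelfSimilar
import Literature.Analysis.FluidPDE.SuitableWeak
import Summits.NavierStokesRegularity.NavierStokesRegularity.Theorems.TypeICertificateLadderNoBlowupToClay
import Summits.NavierStokesRegularity.NavierStokesRegularity.Theorems.HubbleDynamoAssembly
import Summits.NavierStokesRegularity.NavierStokesRegularity.Theorems.HubbleDynamoDilutionBudgetClose

/-!
Route: HubbleDynamo

DORMANT since 2026-09-04T10:52:42Z (reconciler: no traction for 5 d (last activity statement-claimed at 2026-08-30T10:20:50Z); parked, not closed — `ledger route dormant route-NavierStokesRegularity-HubbleDynamo --off` to reactivate) — unstaffed, not closed; items shared with open routes are served there. `ledger route dormant <id> --off` reactivates.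

# Route HubbleDynamo — NavierStokesRegularity (Clay A), positive side; realises card
NavierStokesRegularity/NavierStokesRegularity/self-dynamo-hubble-flow ("A Type-I singularity is a
self-excited dynamo in an expanding universe: Leray-rescaled vorticity obeys the induction equation
in the Hubble flow U + ay; Liouville = anti-dynamo")

## Thesis X = NoSelfExcitedDynamo ∧ FarFieldSlaving (it suffices to show these two, together with
the shared crux NoTypeII)
DICTIONARY (exact; card D0, support item SteadyInductionIdentity): put u(x,t) = λ U(λx, s), λ =
(2a(T−t))^{-1/2}, ds/dt = λ². Then the rescaled vorticity Ω = curl U satisfies, with NO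
approximation,
   ∂_s Ω = νΔΩ + curl(V × Ω),   V := U + a y,   div V = 3a,   U = curl^{-1} Ω,
i.e. the kinematic INDUCTION EQUATION of MHD for a "magnetic field" Ω advected by the profile flow
plus a uniform Hubble expansion a y, with magnetic diffusivity ν (the two Leray terms −2aΩ − a y·∇Ω
are exactly curl(a y × Ω)); and the field is SELF-EXCITED: the maintaining flow is the Biot–Savart
velocity of the maintained field. A backward self-similar blow-up = a steady self-excited dynamo, a
λ-DSS blow-up = an s-periodic one, a Type-I ancient solution = a field maintained for all s ∈ ℝ, at
magnetic Reynolds number R_m = C²/(aν) (C = Type-I constant).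
X1 = NoSelfExcitedDynamo (crux, rank 2): no such dynamo exists — every bounded ancient mild solution
of NS (ν = 1) on ℝ³ × (−∞,0) with measurable slices and the pointwise Type-I bound |u(x,t)| ≤ C/(|x|
+ √−t) (KNSS 2009 (1.6), any C) is trivial.
   Lean: ∀ u, Literature.Analysis.FluidPDE.IsBoundedAncientMildSolution 1 u → (∀ t < 0,
AEStronglyMeasurable (u t) volume) → (∃ C, Literature.Analysis.FluidPDE.HasTypeIDecay C u) → ∀ t <
0, u t =ᵐ[volume] 0
X2 = FarFieldSlaving (crux, rank 3): Hubble dilution slaves the far field — for a finite-energy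
classical solution from a rapidly decaying datum with the Type-I rate ‖u(t)‖_∞ ≤ C (T−t)^{-1/2},
EVERY point x₀ is a space-time Type-I centre: |u(x,t)| ≤ C'/(|x − x₀| + √(T−t)) on B_δ(x₀) × (T−δ²,
T) (trivial at regular points; at singular points: Type I in time ⇒ Type I in space, hence finitely
many singular points).
   Lean: ∀ ν T, 0 < ν → 0 < T → ∀ u p, Literature.Analysis.FluidPDE.IsClassicalNSSolutionOn (Set.Ico
0 T) ν 0 u p → Literature.Analysis.FluidPDE.IsLerayHopfOn T ν 0 (u 0) u →
Literature.Analysis.FluidPDE.HasRapidSpatialDecay (u 0) → Literature.Analysis.FluidPDE.IsTypeIBlowup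
u T → ∀ x₀, ∃ δ > 0, ∃ C, ∀ t ∈ Set.Ioo (T − δ^2) T, ∀ x ∈ Metric.ball x₀ δ, ‖u t x‖ ≤ C / (‖x − x₀‖
+ √(T − t))
(both elaborate; planner Sketch.lean rc 0.)

## Assembly X → NavierStokesRegularity
NoSelfExcitedDynamo → FarFieldSlaving → NoTypeII → NoBlowupToClay → NavierStokesRegularity — pure
logic given the zoom glue DynamoKillsTypeI (theorem assembly_of_glue, sorry-free in Sketch.lean): X2
lets the KNSS zoom at a Type-I singular point land in the POINTWISE Type-I class (|v(s,y)| ≤ C'/(|y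
− y*| + √−s), |y*| ≤ C'), X1 kills the limit, so Type-I blow-up of a finite-energy classical
solution from Clay data is impossible; NoTypeII (shared verbatim with route TypeILiouville,
stmt-NavierStokesRegularity-0056) excludes the other rate; NoBlowupToClay (shared verbatim,
stmt-NavierStokesRegularity-0055) is the local Clay theory.

## Two-layer plan (D-0019)
Layer 1 (filed now): cruxes X1 (rank 2), X2 (rank 3), NoTypeII (rank 4, shared); target Thesis = X1
∧ X2; support: DynamoKillsTypeI (zoom glue), NoBlowupToClay (shared), and three Lean-sized pieces of
the dictionary that are provable now — SteadyInductionIdentity (the identity, steady case),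
DilutionBudget (∫Ω·(∇U)Ω = ν‖∇Ω‖² + (a/2)‖Ω‖²: stretching pays Ohmic loss plus exactly a/2 of Hubble
dilution — why Tsai 1998 closes the self-similar case while Galdi's a = 0 steady Liouville problem
is open), BackusRung (LINEAR kinematic anti-dynamo bound in Hubble flow at R_m = C₀²/(aν) < 2 =
Leray's constant); HelicityFluxIdentity (informal until the R → ∞ boundary term is justified).
Layer 2 (later, glued splits, NOT filed): X1 ⇐ KinematicHubbleAntiDynamo(C₁) ∧
SelfConsistencySqueeze(C₁), split by magnetic Reynolds number once the kinematic threshold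
C_kin(1/2, 1) (definition request kinematicHubbleThreshold) is computed; rungs of X1 by field
geometry (approximately axisymmetric profiles = robust Cowling à la Kaiser–Tilgner; zero-entropy
profile flows = no fast dynamo à la Klapper–Young; toroidal/poloidal degeneracies = Bullard–Gellman;
Busse inflow bound; trapped-region/flux-expulsion necessities); X2 ⇐ frozen-flux comparison for
|y|²|Ω| along V-characteristics + a pressure-tail estimate.

Rationale: WHY THIS LINE. Batchelor's vorticity/magnetic-field analogy becomes an IDENTITY in Leray's
similarity variables: the two extra terms −2aΩ − a y·∇Ω of the rescaled vorticity equation are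
exactly curl(a y × Ω), so Ω solves the kinematic induction equation in the Hubble flow V = U + a y,
and Type-I Liouville problems are SELF-EXCITED (fast-)dynamo problems at magnetic Reynolds number
R_m = C²/(aν) (card self-dynamo-hubble-flow; MHD side: Batchelor1950, Cowling1933,
BullardGellman1954, Backus1958, KlapperYoung1995, FriedlanderVishik1991; NS side: Leray1934,
NecasRuzickaSverak1996, Tsai1998, KochNadirashviliSereginSverak2009, SereginSverak2009,
ChaeWolf2017RemovingDSS, AlbrittonBarker2019, BradshawTsai2017CPDE). The dictionary reproduces every
known Type-I exclusion as an anti-dynamo theorem — small constant = Backus bound (support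
BackusRung); axisymmetric = Cowling (Γ = r u_θ is the poloidal flux function with a sourceless
drift–diffusion equation; HasTypeIDecay gives |u| ≤ C/|x'| so KNSS Thm 5.3 is exactly this case);
2.5-D = Zeldovich; steady = no steady dynamo through the exact −a/2 dilution bonus (support
DilutionBudget) — and predicts the open frontier (swirl imposed at infinity = AX-L). Imported areas:
kinematic dynamo theory (necessary conditions for field maintenance that are geometric/Lagrangian
rather than norm-based; principal growth rates of L_V = νΔ + curl(V×·), certifiable by eigenvalue
computation + interval arithmetic) and MHD energetics (magnetic-helicity balance). What the route
adds to TypeILiouville (whose Liouville crux is the structureless (L), stmt-0057): the Liouville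
statement is cut down to the POINTWISE Type-I class — the class in which Ω ∈ L²_y, frozen flux,
dilution and helicity flux make sense — (X1, strictly weaker than (L) and than
¬NontrivialTypeIAncientExists, containing Tsai's Conj. 8.8 / Bradshaw–Tsai OP 5.1 after a unit
time-shift), and the price of that class is isolated as its own crux X2 (Type I in time ⇒ Type I in
space at every point), which the dictionary PREDICTS (frozen-flux dilution of whatever the core
emits forces |Ω| ~ |y|^{-2}, |U| ~ |y|^{-1}) and which is known only in axisymmetry (KNSS2009 Thm
6.2, SereginSverak2009) and for backward DSS in L^p (ChaeWolf2017RemovingDSS Thm 1.1).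

RANKED CRUXES. #2 NoSelfExcitedDynamo — hardest and most informative (its refutation is a Type-I
profile, e.g. Blowup's BlowupTypeIDssProfile stmt-0155). #3 FarFieldSlaving — new statement; nearest
results are finiteness of the singular set under the STRONGER L^∞_t L^{3,∞}_x Type-I condition
(ChoeWolfYang2019; Barker2024 = arXiv:2111.14776, O(M^20) points); open under the sup-norm rate. #4
NoTypeII — shared verbatim with TypeILiouville (stmt-0056); the dictionary is silent on Type II
(said in BARRIERS).

KILL CRITERIA. A nontrivial bounded ancient mild solution with pointwise Type-I decay (backward
DSS/RDSS profile, Hou-type limit) refutes #2 and closes the route (refuted:NoSelfExcitedDynamo). A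
Type-I-in-time blow-up or ancient solution whose similarity-variable far field does not decay like
1/|y| refutes #3; the route then only survives by retreating to the Albritton–Barker Morrey class,
i.e. it is superseded by TypeILiouville's (L′) and should be closed superseded. A Type-II blow-up
from Schwartz data refutes #4 and every positive route. A kinematic dynamo in Hubble flow with
Type-I tails at amplitude below every provable squeeze threshold kills the planned R_m-split of #2
(not the route). Cheapest refuter probe (card): principal growth rate of L_{U_H + y/2} for Hou's
rescaled near-singular velocity U_H frozen at one time (negative ⇒ kinematic relaxation too lossy;
positive with a coherent smooth mode at R_m ~ 10³ ⇒ the naive squeeze is dead).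

DELIBERATELY NOT DECOMPOSED. (a) The R_m-split of #2 into KinematicHubbleAntiDynamo(C₁) ∧
SelfConsistencySqueeze(C₁): needs the NUMBER C_kin(1/2,1) first (definition request
kinematicHubbleThreshold; optimal-kinematic-dynamo eigenvalue computation as a tenure kit job); the
squeeze (flux cancellation of maintained fields ⇒ Biot–Savart velocity too weak to beat the Hubble
speed a|y| on the core) is not yet statable with a constant and is where a new mechanism would live.
(b) Geometric rungs of #2 (approximately axisymmetric profiles via robust Cowling, Kaiser–Tilgner
arXiv:1210.7122 and Kaiser 2018 doi:10.1137/18m1173174; Busse inflow bound; trapped-region /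
flux-expulsion necessities; zero-entropy profile flows) — to be attached with --supports
NoSelfExcitedDynamo. (c) The helicity-flux solvability identity (card (v)): boundary term at R → ∞
in the Chae–Wolf decay class is O(1) termwise and its convergence must be shown before a signature
is set — filed informal. (d) The proof architecture of #3 (frozen-flux comparison for |y|²|Ω| along
V-characteristics, pressure tail) and of the zoom glue (named KNSS facts as hypotheses if the
grounder so rules).

NOVELTY / BARRIERS: in the route's novelty and barriers fields (search log: zbMATH 'antidynamo
theorem' → Arnold 1982, Kaiser–Tilgner 2014, Kaiser 2018; zbMATH/crossref 'vorticity magnetic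
analogy dynamo Navier–Stokes self-similar', 'Leray similarity variables vorticity induction equation
dynamo blow-up' → nothing joining the two sides; Semantic Scholar 'Type I blow-up Navier–Stokes
singular points finite' → Barker2024, ChoeWolfYang2019; zbMATH 'Liouville ancient solutions
Navier–Stokes Type I' → AlbrittonBarker2019, LeiZhang 2011; galaxy/searchd rc 75 at query time, the
card's refuter audit (new-combination) stands).

Novelty: NEAREST PRIOR ART (searched 2026-08-15: lit search --source zbmath/crossref/s2; galaxy + local
searchd returned rc 75 at query time; the card's own audit by
refuter-novelty-audit-NavierStokesRegularity-NavierStokesRegularity-5-0 graded it new-combination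
and stands). Dictionary source: Batchelor1950 (doi:10.1098/rspa.1950.0069, vorticity/magnetic-field
analogy in physical variables); 'dynamo theory for vorticity' precedent: FriedlanderVishik1991
(doi:10.1063/1.165829, fast-dynamo methods for linearised Euler, physical variables); fast-dynamo
bound KlapperYoung1995 (doi:10.1007/BF02101659); antidynamo theorems Cowling1933,
BullardGellman1954, Backus1958, Arnold 1982 (zbl:0532.58034), Kaiser–Tilgner 2014 (arXiv:1210.7122),
Kaiser 2018 (doi:10.1137/18m1173174). NS objects being re-read: KochNadirashviliSereginSverak2009
(arXiv:0709.3599, Thms 5.1–5.3, 6.2, Prop 6.1), SereginSverak2009 (arXiv:0804.1803),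
ChaeWolf2017RemovingDSS (arXiv:1610.09464, Thms 1.1, 1.3), AlbrittonBarker2019 (arXiv:1811.00502,
Thm 1.1), BradshawTsai2017CPDE (Open Problem 5.1), NecasRuzickaSverak1996, Tsai1998. For crux
FarFieldSlaving: ChoeWolfYang2019 (doi:10.1007/s00208-019-01843-2) and Barker2024
(arXiv:2111.14776): finitely many singular points under the L^∞_t L^{3,∞}_x Type-I condition — not
under the sup-norm rate (T−t)^{1/2}‖u‖_∞ ≤ M, and no pointwise space decay. In-tree neighbours:
route TypeILiouville (crux (L) = stmt-NavierStokesRegularity-0057 and glue 0058 in the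
Albritton–Barker/KNSS class),  [refs: 10.1098/rspa.1950.0069, 10.1063/1.165829, 10.1007/BF02101659, 10.1137/18m1173174, 10.1007/s00208-019-01843-2, 1210.7122, 0709.3599, 0804.1803, 1610.09464, 1811.00502, 2111.14776, 1703.10822, doi:10.1098/rspa.1950.0069, doi:10.1063/1.165829, doi:10.1007/BF02101659, doi:10.1137/18m1173174, doi:10.1007/s00208-019-01843-2, Batchelor1950, FriedlanderVishik1991, KlapperYoung1995, Cowling1933, BullardGel]

Barriers (technique_class: dynamo-transplant liouville-rigidity type-I-blowup-rate): technique_class: dynamo-transplant liouville-rigidity type-I-blowup-rate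
- Literature.Barriers.NavierStokesRegularity.TaoAveragedBlowup: NOT evaded by the route as a whole —
crux NoTypeII is false for averaged NS (Tao's blow-up is Type II, arXiv:1402.0290 p.8) and any proof
of it must use fine structure (shared bet with TypeILiouville: backward uniqueness / vorticity
geometry). The dynamo half (NoSelfExcitedDynamo, FarFieldSlaving, the three identities) lives on the
exact Lie-transport form curl(V × Ω) of the vorticity equation, which an averaged bilinear operator
B̃ does not possess (no frozen flux, no Cowling flux function, no magnetic-helicity balance, no
induction operator), so the imported necessary conditions are outside the 'abstract bilinear
estimates' class the barrier kills.
- Literature.Barriers.NavierStokesRegularity.TruncatedDyadicBlowup: same answer —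
energy-identity-plus-harmonic-analysis is not what is imported; anti-dynamo theorems are maximum
principles for transported scalars (y·Ω, flux functions) and spectral statements about the true
induction operator L_V = νΔ + curl(V×·).
- Literature.Barriers.NavierStokesRegularity.TruncatedDyadicTypeIBlowup: blocks Type-I/DSS exclusion
by arguments insensitive to averaging and to exogenous time-dependence of the nonlinearity; every
tool here (frozen flux and Hubble dilution, Cowling/Bullard–Gellman, magnetic helicity, growth rates
of curl(V×·), and above all SELF-CONSISTENCY U = curl^{-1}Ω) exists only for the exact a

Novelty grade: new-combination — ROUTE REVIEW (refuter 2026-08-15): keep open, no crux blocked; REVIEW_R4_*.md + W4.lean attached. 8 decls rc0; Assembly re-proved sorry-free from the glue DynamoKillsTypeI. Dictionary verified by hand, signs included: 1937 curl[(y·∇)U] = Ω+(y·∇)Ω, curl[(U·∇)U] = −curl(U×Ω), curl(ay×Ω) = −2aΩ − a(y·∇ (refuter refuter-rreview-route-HodgeConjecture-Co-9cfa3678-0, 2026-08-15T12:41:56Z; prior: doi:10.1098/rspa.1950.0069 (Batchelor1950 vorticity/magnetic-field analogy), arXiv:0709.3599 (KNSS2009 Thms 5.1-5.3, 6.2, (1.6)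 Type-I class), arXiv:0804.1803 (SereginSverak2009), arXiv:1610.09464 (ChaeWolf2017RemovingDSS), BradshawTsai2017CPDE OP 5.1, Tsai1998, NecasRuzickaSverak1996, arXiv:1811.00502 (AlbrittonBarker2019 Thm 1.1), arXiv:2111.14776 (Barker2024, finitely many singular points under)

History (route lifecycle, newest last):
- 2026-09-04T10:52:42Z · DORMANT — reconciler: no traction for 5 d (last activity statement-claimed at 2026-08-30T10:20:50Z); parked, not closed — `ledger route dormant route-NavierStokesRegulari (operator:999:3928341)

sub-problem: NavierStokesRegularity · status: dormant · opened planner-plancard-NavierStokesRegularity-Navie-e7428acd-0 2026-08-15T10:59:45Z · rev 2 · ledger route-NavierStokesRegularity-HubbleDynamo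
GENERATED by the gate from the ledger (D-0016/17). Provers cite these decls: `theorem foo : Summit.NavierStokesRegularity.NavierStokesRegularity.Theses.HubbleDynamo.<Decl> := …` in Summits/NavierStokesRegularity/NavierStokesRegularity/Theorems/<Name>.lean.
-/

namespace Summit.NavierStokesRegularity.NavierStokesRegularity.Theses.HubbleDynamo

open scoped BigOperators Topology Manifold Classical MeasureTheory ProbabilityTheory Matrix InnerProductSpace ComplexConjugate ContinuousMap
open Filter Set Function TopologicalSpace MeasureTheory

attribute [summit_statement] _root_.NavierStokesRegularity

open Literature.NS

/-- item stmt-NavierStokesRegularity-1933 · target · rank 0 · open · by planner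
why it might fail: X1 fails iff a bounded Type-I ancient profile (self-excited dynamo in Hubble flow; e.g. time-shifted backward DSS/RDSS, excluded only for λ near 1 or small C, ChaeWolf2017 Thm 1.3) exists; X2 fails if an ODE-rate Type-I blow-up has a non-isolated singular point or profile slower than 1/|x−x₀|.
sources: KochNadirashviliSereginSverak2009, ChaeWolf2017RemovingDSS, BradshawTsai2017CPDE, AlbrittonBarker2019, ChoeWolfYang2019, Barker2024
[target] X = NoSelfExcitedDynamo ∧ FarFieldSlaving (card self-dynamo-hubble-flow): (X1) no
self-excited dynamo in Hubble flow — every bounded ancient mild solution (ν = 1) with measurable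
slices and the pointwise Type-I bound |u| ≤ C/(|x| + √−t) is trivial; (X2) Hubble dilution slaves
the far field — for finite-energy classical solutions from rapidly decaying data with the Type-I
rate, every point is a space-time Type-I centre. With the shared crux NoTypeII and the shared local
Clay theory this gives Clay (A) (item Assembly; glue DynamoKillsTypeI). -/
@[route_item "route-NavierStokesRegularity-HubbleDynamo"]
def Thesis : Prop :=
  (∀ u : ℝ → EuclideanSpace ℝ (Fin 3) → EuclideanSpace ℝ (Fin 3), Literature.Analysis.FluidPDE.IsBoundedAncientMildSolution 1 u → (∀ t < 0, MeasureTheory.AEStronglyMeasurable (u t) MeasureTheory.volume) → (∃ C : ℝ, Literature.Analysis.FluidPDE.HasTypeIDecay C u) → ∀ t < 0, u t =ᵐ[MeasureTheory.volume] 0) ∧ (∀ (ν T : ℝ), 0 < ν → 0 < T → ∀ (u : ℝ → EuclideanSpace ℝ (Fin 3) → EuclideanSpace ℝ (Fin 3)) (p : ℝ → EuclideanSpace ℝ (Fin 3) → ℝ), Literature.Analysis.FluidPDE.IsClassicalNSSolutionOn (Set.Ico 0 T) ν 0 u p → Literature.Analysis.FluidPDE.IsLerayHopfOn T ν 0 (u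 0) u → Literature.Analysis.FluidPDE.HasRapidSpatialDecay (u 0) → Literature.Analysis.FluidPDE.IsTypeIBlowup u T → ∀ x₀ : EuclideanSpace ℝ (Fin 3), ∃ δ : ℝ, 0 < δ ∧ ∃ C : ℝ, ∀ t ∈ Set.Ioo (T - δ ^ 2) T, ∀ x ∈ Metric.ball x₀ δ, ‖u t x‖ ≤ C / (‖x - x₀‖ + Real.sqrt (T - t)))

/-- item stmt-NavierStokesRegularity-1934 · crux · rank 2 · open · by planner
why it might fail: False iff a nontrivial bounded ancient mild solution with |u| ≤ C/(|x|+√−t) exists, e.g. a backward λ-DSS/RDSS Type-I profile shifted one time unit (in-tree IsTypeIDSSProfile ⇒ ¬X1): excluded only for λ near 1 or small C (ChaeWolf2017 Thm 1.3, Rmk 1.4); Tsai Conj 8.8 / Bradshaw–Tsai OP 5.1 open.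
sources: KochNadirashviliSereginSverak2009, ChaeWolf2017RemovingDSS, arXiv:1610.09464, BradshawTsai2017CPDE, AlbrittonBarker2019, arXiv:1811.00502
[crux] NO SELF-EXCITED DYNAMO IN HUBBLE FLOW (card self-dynamo-hubble-flow, thesis object). In
similarity variables a bounded ancient mild solution with the pointwise Type-I bound |u| ≤ C/(|x| +
√−t) is a profile flow U(y,s), |U| ≲ C/(1+|y|), whose vorticity Ω = curl U obeys EXACTLY the
kinematic induction equation ∂_sΩ = νΔΩ + curl(V × Ω), V = U + a y (div V = 3a): a field maintained
for all s by the Biot–Savart velocity of itself, at magnetic Reynolds number R_m = C²/(aν).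
Statement: every such solution is trivial (a.e.-zero slices) — the KNSS-class pointwise Type-I
Liouville theorem; strictly weaker than (L) = stmt-NavierStokesRegularity-0057 (the decay kills
constants) and than ¬NontrivialTypeIAncientExists (Albritton–Barker Morrey class ⊇ pointwise class
up to pressure/gradient bookkeeping); contains Tsai's Conj. 8.8 / TypeIDSSLiouvilleConjecture (shift
a backward DSS solution by one time unit: it becomes bounded on (−∞,0) and keeps HasTypeIDecay).
Known cases = the anti-dynamo theorems of the dictionary: axisymmetric (HasTypeIDecay ⇒ |u| ≤ C/|x'|
⇒ KNSS Thm 5.3; = Cowling: Γ = r u_θ is a flux function with a sourceless drift–diffusion equation),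
small constant (Backus bound, -/
@[route_item "route-NavierStokesRegularity-HubbleDynamo"]
def NoSelfExcitedDynamo : Prop :=
  ∀ u : ℝ → EuclideanSpace ℝ (Fin 3) → EuclideanSpace ℝ (Fin 3), Literature.Analysis.FluidPDE.IsBoundedAncientMildSolution 1 u → (∀ t < 0, MeasureTheory.AEStronglyMeasurable (u t) MeasureTheory.volume) → (∃ C : ℝ, Literature.Analysis.FluidPDE.HasTypeIDecay C u) → ∀ t < 0, u t =ᵐ[MeasureTheory.volume] 0

/-- item stmt-NavierStokesRegularity-1935 · crux · rank 3 · open · by planner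
why it might fail: The ODE rate gives Morrey-type bounds at every point (Seregin–Zajączkowski; arXiv:1906.08225 p.6) but NOT the pointwise profile C′/|x−x₀| nor isolated singular points: finiteness known only under L^{3,∞} bounds (ChoeWolfYang2019, Barker2024), pointwise only axisym (KNSS Thm 6.2) / DSS (ChaeWolf).
sources: KochNadirashviliSereginSverak2009, SereginSverak2009, ChaeWolf2017RemovingDSS, ChoeWolfYang2019, Barker2024, arXiv:2111.14776
[crux] HUBBLE DILUTION SLAVES THE FAR FIELD (card (ii): frozen-flux dilution forces the profile
tails |Ω| ~ |y|^{-2}, |U| ~ |y|^{-1}). Statement: for a finite-energy classical solution from a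
rapidly decaying datum with the Type-I rate ‖u(t)‖_∞ ≤ C (T−t)^{-1/2}, EVERY point x₀ is a
space-time Type-I centre: |u(x,t)| ≤ C'/(|x − x₀| + √(T−t)) on B_δ(x₀) × (T−δ², T) (δ, C' depending
on x₀; trivially true at regular points; at singular points it says Type I in time ⇒ Type I in
space, hence isolated, hence finitely many singular points). Exactly what the KNSS zoom needs to
land in the pointwise class of NoSelfExcitedDynamo (glue DynamoKillsTypeI) instead of the
all-centres Morrey class of AlbrittonBarker2019 Thm 1.1. Known: axisymmetric (KNSS2009 Thm 6.2 /
SereginSverak2009: the rate gives |u| ≤ C/r, in-tree KNSS2009_typeI_rate_rMulNorm_bounded), backward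
λ-DSS in L^p (ChaeWolf2017 Thm 1.1: |u| ≤ C/(√−t + |x|)), and finiteness of the singular set under
the STRONGER L^∞_t L^{3,∞}_x Type-I condition (ChoeWolfYang2019; Seregin 2020; Barker2024 =
arXiv:2111.14776: ≤ O(M^20) points); under the sup-norm rate alone it is open. Dynamo reading and
intended proof: outside the core |y| ≲ C/a the t -/
@[route_item "route-NavierStokesRegularity-HubbleDynamo"]
def FarFieldSlaving : Prop :=
  ∀ (ν T : ℝ), 0 < ν → 0 < T → ∀ (u : ℝ → EuclideanSpace ℝ (Fin 3) → EuclideanSpace ℝ (Fin 3)) (p : ℝ → EuclideanSpace ℝ (Fin 3) → ℝ), Literature.Analysis.FluidPDE.IsClassicalNSSolutionOn (Set.Ico 0 T) ν 0 u p → Literature.Analysis.FluidPDE.IsLerayHopfOn T ν 0 (u 0) u → Literature.Analysis.FluidPDE.HasRapidSpatialDecay (u 0) → Literature.Analysis.FluidPDE.IsTypeIBlowup u T → ∀ x₀ : EuclideanSpace ℝ (Fin 3), ∃ δ : ℝ, 0 < δ ∧ ∃ C : ℝ, ∀ t ∈ Set.Ioo (T - δ ^ 2) T, ∀ x ∈ Metric.ball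 x₀ δ, ‖u t x‖ ≤ C / (‖x - x₀‖ + Real.sqrt (T - t))

/-- item stmt-NavierStokesRegularity-0056 · crux · rank 4 · open · by planner
why it might fail: No theorem bounds a blow-up rate from above: Tao's averaged-NS blow-up is Type II (arXiv:1402.0290), so energy-level methods cannot prove it; axisymmetric singularities are Type II (KNSS2009), so Hou's candidate (arXiv:2107.06509), if real, refutes it; only special scenarios excluded (2507.08733).
sources: Tao2016AveragedNS, KochNadirashviliSereginSverak2009, Hou2022PotentiallySingularNS, Seregin2012, EscauriazaSereginSverak2003, arXiv:2507.08733
If a finite-energy classical solution from a rapidly decaying datum has maximal lifespan T<∞ (no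
classical extension past T), then ‖u(t)‖_∞ ≤ C (T−t)^{-1/2} eventually as t↑T (Leray's rate is the
matching lower bound, leray_blowup_rate_top). The hardest and most informative crux: a
counterexample is a Type II singularity, i.e. ¬(Clay A). Known: lower bound c√ν (T−t)^{-1/2} (Leray
1934 §20); L³ must blow up (ESS 2003, Seregin 2012); only triple-log quantitative gain (Tao 2021). -/
@[route_item "route-NavierStokesRegularity-HubbleDynamo"]
def NoTypeII : Prop :=
  ∀ (ν T : ℝ), 0 < ν → 0 < T → ∀ (u : ℝ → EuclideanSpace ℝ (Fin 3) → EuclideanSpace ℝ (Fin 3)) (p : ℝ → EuclideanSpace ℝ (Fin 3) → ℝ), Literature.Analysis.FluidPDE.IsMaximalSmoothSolution ν 0 u p T → Literature.Analysis.FluidPDE.IsLerayHopfOn T ν 0 (u 0) u → Literature.Analysis.FluidPDE.HasRapidSpatialDecay (u 0) → Literature.Analysis.FluidPDE.IsTypeIBlowup u T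

/-- item stmt-NavierStokesRegularity-0055 · support · rank 9 · closed · proved by Summit.NavierStokesRegularity.NavierStokesRegularity.Theorems.typeICertificateLadder_noBlowupToClay_proof @ 8d57e70af7e2 (prover) · by planner
sources: Leray1934, Fefferman2000
Given NoBlowup, build the Clay (A) solution: local finite-energy classical solution for smooth
divergence-free rapidly decaying data (Leray 1934 §III / Fujita–Kato 1964 + LPS smoothing), continue
past every T using NoBlowup, glue by weak–strong uniqueness (Prodi–Serrin), bounded energy from the
energy inequality, and convert with
Literature.Analysis.FluidPDE.isNavierStokesSolution_and_smooth_iff. Blow-up at spatial infinity is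
excluded by CKN ε-regularity applied far out. May take named Literature facts (leray_existence_R3,
ladyzhenskaya_prodi_serrin, weak_strong_uniqueness, fujita_kato_local) as hypotheses if the grounder
so rules. -/
@[route_item "route-NavierStokesRegularity-HubbleDynamo"]
def NoBlowupToClay : Prop :=
  (∀ (ν T : ℝ), 0 < ν → 0 < T → ∀ (u : ℝ → EuclideanSpace ℝ (Fin 3) → EuclideanSpace ℝ (Fin 3)) (p : ℝ → EuclideanSpace ℝ (Fin 3) → ℝ), Literature.Analysis.FluidPDE.IsClassicalNSSolutionOn (Set.Ico 0 T) ν 0 u p → Literature.Analysis.FluidPDE.IsLerayHopfOn T ν 0 (u 0) u → Literature.Analysis.FluidPDE.HasRapidSpatialDecay (u 0) → Literature.Analysis.FluidPDE.HasSmoothExtensionPast ν 0 u T) → NavierStokesRegularity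

/-- `NoBlowupToClay` holds: proved by `Summit.NavierStokesRegularity.NavierStokesRegularity.Theorems.typeICertificateLadder_noBlowupToClay_proof` @ 8d57e70af7e2. -/
theorem NoBlowupToClay_holds : NoBlowupToClay := _root_.Summit.NavierStokesRegularity.NavierStokesRegularity.Theorems.typeICertificateLadder_noBlowupToClay_proof

/-- item stmt-NavierStokesRegularity-1936 · support · rank 9 · closed · proved by Summit.NavierStokesRegularity.NavierStokesRegularity.Theorems.hubbleDynamo_dynamoKillsTypeI_proof (prover) · by planner
sources: KochNadirashviliSereginSverak2009, SereginSverak2009, AlbrittonBarker2019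
[support] ZOOM GLUE: NoSelfExcitedDynamo → FarFieldSlaving → no Type-I blow-up for finite-energy
classical solutions from rapidly decaying data (conclusion HasSmoothExtensionPast). Plan (KNSS2009
§6 in the pointwise class): rescale ν to 1 (u ↦ ν^{-1}u(·/ν)); if no extension then ‖u(t)‖_∞ ↑ ∞ as
t ↑ T (continuation; in-tree shape hasSmoothExtensionPast_of_bounded) while the far field stays
bounded (CKN far out / LerayFarFieldRegularity), so near-maximum points (x_k,t_k)
(KNSSTypeIIZoomIn.exists_near_max) have x_k → x*; FarFieldSlaving at x* gives |u| ≤ C'/(|x−x*| +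
√(T−t)) near (x*,T), whence |x_k − x*| ‖u(t_k)‖_∞ ≤ C'; the KNSS zoom v_k(s,y) = λ_k u(t_k + λ_k² s,
x_k + λ_k y), λ_k = 1/‖u(t_k)‖_∞, converges (KNSS2009_blowup_generates_ancient; IsKNSSBlowupLimit:
bounded ancient mild, smooth, |v| ≤ 1 = sup |v|) and inherits |v(s,y)| ≤ C'/(|y − y*| + √(τ* − s)) ≤
C'/(|y − y*| + √−s) with |y*| ≤ C', τ* = lim (T−t_k)/λ_k² ∈ [0, C²]; translating y* to 0
(translation invariance of the mild class) gives HasTypeIDecay C', so NoSelfExcitedDynamo forces v ≡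
0 (smooth slices a.e. zero), contradicting IsKNSSBlowupLimit.nontrivial. May take the named
Literature facts (KNSS2009_blowup_generates_an -/
@[route_item "route-NavierStokesRegularity-HubbleDynamo"]
def DynamoKillsTypeI : Prop :=
  (∀ u : ℝ → EuclideanSpace ℝ (Fin 3) → EuclideanSpace ℝ (Fin 3), Literature.Analysis.FluidPDE.IsBoundedAncientMildSolution 1 u → (∀ t < 0, MeasureTheory.AEStronglyMeasurable (u t) MeasureTheory.volume) → (∃ C : ℝ, Literature.Analysis.FluidPDE.HasTypeIDecay C u) → ∀ t < 0, u t =ᵐ[MeasureTheory.volume] 0) → (∀ (ν T : ℝ), 0 < ν → 0 < T → ∀ (u : ℝ → EuclideanSpace ℝ (Fin 3) → EuclideanSpace ℝ (Fin 3)) (p : ℝ → EuclideanSpace ℝ (Fin 3) → ℝ), Literature.Analysis.FluidPDE.IsClassicalNSSolutionOn (Set.Ico 0 T) ν 0 u p → Literature.Analysis.FluidPDE.IsLerayHopfOn T ν 0 (u 0) u → Literature.Analysis.FluidPDE.HasRapidSpatialDecay (u 0) → Literature.Analysis.FluidPDE.IsTypeIBlowup u T → ∀ x₀ : EuclideanSpace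 ℝ (Fin 3), ∃ δ : ℝ, 0 < δ ∧ ∃ C : ℝ, ∀ t ∈ Set.Ioo (T - δ ^ 2) T, ∀ x ∈ Metric.ball x₀ δ, ‖u t x‖ ≤ C / (‖x - x₀‖ + Real.sqrt (T - t))) → ∀ (ν T : ℝ), 0 < ν → 0 < T → ∀ (u : ℝ → EuclideanSpace ℝ (Fin 3) → EuclideanSpace ℝ (Fin 3)) (p : ℝ → EuclideanSpace ℝ (Fin 3) → ℝ), Literature.Analysis.FluidPDE.IsClassicalNSSolutionOn (Set.Ico 0 T) ν 0 u p → Literature.Analysis.FluidPDE.IsLerayHopfOn T ν 0 (u 0) u → Literature.Analysis.FluidPDE.HasRapidSpatialDecay (u 0) → Literature.Analysis.FluidPDE.IsTypeIBlowup u T → Literature.Analysis.FluidPDE.HasSmoothExtensionPast ν 0 u T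

-- `DynamoKillsTypeI` holds: proved by `Summit.NavierStokesRegularity.NavierStokesRegularity.Theorems.hubbleDynamo_dynamoKillsTypeI_proof` (its module imports this route file, so no `_holds` link can be stated here).

/-- item stmt-NavierStokesRegularity-1937 · support · rank 9 · closed · proved by Summit.NavierStokesRegularity.NavierStokesRegularity.Theorems.hubbleDynamo_steadyInductionIdentity_proof (prover) · by planner
sources: Batchelor1950, Leray1934, NecasRuzickaSverak1996
[support] THE DICTIONARY, steady case (card D0; Lean-sized, provable now): for a smooth Leray
profile (−νΔU + aU + a(y·∇)U + (U·∇)U + ∇P = 0, div U = 0; in-tree IsLerayProfile ν a U P) the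
vorticity Ω = curl U satisfies νΔΩ + curl((U + a y) × Ω) = 0 pointwise — the STEADY kinematic
induction equation of MHD for a 'magnetic field' Ω in the compressible velocity V = U + a y (div V =
3a, uniform Hubble expansion) with magnetic diffusivity ν: a backward self-similar profile is
literally a steady self-excited dynamo (U = curl^{-1}Ω, no Lorentz force, no drive). Proof: curl of
the profile equation; curl[(y·∇)U] = Ω + (y·∇)Ω, curl(aU) = aΩ, curl[(U·∇)U] = −curl(U × Ω), and
curl(a y × Ω) = −2aΩ − a(y·∇)Ω (in-tree curl/cross conventions; divergence_cross). The s-dependent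
version ∂_sΩ = νΔΩ + curl(V×Ω) for the time-dependent Leray equation (e.g. the Bradshaw–Tsai
periodic Leray system, PeriodicLeraySystem.lean) is the same computation and rides as a --supports
lemma. Batchelor1950's analogy made an identity by the similarity variables; no induction-form
statement exists in Literature/Analysis/FluidPDE (SelfSimilar*, LerayProfile*, PeriodicLeray*). -/
@[route_item "route-NavierStokesRegularity-HubbleDynamo"]
def SteadyInductionIdentity : Prop :=
  ∀ (ν a : ℝ) (U : EuclideanSpace ℝ (Fin 3) → EuclideanSpace ℝ (Fin 3)) (P : EuclideanSpace ℝ (Fin 3) → ℝ), ContDiff ℝ (⊤ : ℕ∞) U → ContDiff ℝ (⊤ : ℕ∞) P → Literature.Analysis.FluidPDE.IsLerayProfile ν a U P → ∀ y, ν • Laplacian.laplacian (Literature.Analysis.FluidPDE.curl U) y + Literature.Analysis.FluidPDE.curl (fun z => Literature.Analysis.FluidPDE.cross (U z + a • z) (Literature.Analysis.FluidPDE.curl U z)) y = 0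

-- `SteadyInductionIdentity` holds: proved by `Summit.NavierStokesRegularity.NavierStokesRegularity.Theorems.hubbleDynamo_steadyInductionIdentity_proof` (its module imports this route file, so no `_holds` link can be stated here).

/-- item stmt-NavierStokesRegularity-1938 · support · rank 9 · closed · proved by Summit.NavierStokesRegularity.NavierStokesRegularity.Theorems.hubbleDynamo_dilutionBudget_proof (prover) · by planner
sources: Tsai1998, NecasRuzickaSverak1996, Galdi2011
[support] THE DILUTION BONUS (card D0; provable now): for a smooth Leray profile with Type-I tails
(|U| ≤ C/(1+|y|), |∇U| ≤ C/(1+|y|)², |∇Ω| ≤ C/(1+|y|)³ — the NRŠ/Chae–Wolf decay class) the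
enstrophy budget of the steady induction equation reads ∫ Ω·(∇U)Ω = ν ∫|∇Ω|² + (a/2) ∫|Ω|²: vortex
stretching must pay the Ohmic loss PLUS exactly a/2 of Hubble dilution (−2a from curl(a y × Ω)
against +3a/2 from transport by the diverging flow, div V = 3a). At a = 0 (steady NS: Galdi's
Liouville problem, crux GaldiLiouville of route GaldiLiouvilleGate) the bonus disappears — the
dictionary's explanation of why Tsai1998/NRŠ close the self-similar case while the steady case is
open. All integrations by parts are absolutely convergent in the stated class (|V||Ω|² R² ~ a/R on
spheres). -/
@[route_item "route-NavierStokesRegularity-HubbleDynamo"]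
def DilutionBudget : Prop :=
  ∀ (ν a : ℝ) (U : EuclideanSpace ℝ (Fin 3) → EuclideanSpace ℝ (Fin 3)) (P : EuclideanSpace ℝ (Fin 3) → ℝ), ContDiff ℝ (⊤ : ℕ∞) U → ContDiff ℝ (⊤ : ℕ∞) P → Literature.Analysis.FluidPDE.IsLerayProfile ν a U P → (∃ C : ℝ, ∀ y, ‖U y‖ ≤ C / (1 + ‖y‖) ∧ ‖fderiv ℝ U y‖ ≤ C / (1 + ‖y‖) ^ 2 ∧ ‖fderiv ℝ (Literature.Analysis.FluidPDE.curl U) y‖ ≤ C / (1 + ‖y‖) ^ 3) → ∫ y, inner ℝ (Literature.Analysis.FluidPDE.curl U y) (fderiv ℝ U y (Literature.Analysis.FluidPDE.curl U y)) = (a / 2) * (∫ y, ‖Literature.Analysis.FluidPDE.curl U y‖ ^ 2) + ν * ∫ y, Literature.Analysis.FluidPDE.frobeniusNormSq (fderiv ℝ (Literature.Analysis.FluidPDE.curl U) y)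

/-- `DilutionBudget` holds: proved by `Summit.NavierStokesRegularity.NavierStokesRegularity.Theorems.hubbleDynamo_dilutionBudget_proof`. -/
theorem DilutionBudget_holds : DilutionBudget := _root_.Summit.NavierStokesRegularity.NavierStokesRegularity.Theorems.hubbleDynamo_dilutionBudget_proof

/-- item stmt-NavierStokesRegularity-1939 · support · rank 9 · closed · proved by Summit.NavierStokesRegularity.NavierStokesRegularity.Theorems.hubbleDynamo_backusRung_proof @ 8723bd60c0b6 (prover) · by planner
sources: Backus1958, Leray1934, ChaeWolf2017RemovingDSS
[support] BACKUS BOUND IN HUBBLE FLOW = LERAY'S CONSTANT (card D1, first rung of the kinematic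
ladder; LINEAR, provable now): if the advecting field U (smooth, divergence-free, bounded gradient,
NOT required to be curl^{-1}b) has sup|U| ≤ C₀ with C₀² < 2aν, the induction operator L_V = νΔ +
curl((U + a y) × ·) has no non-decaying normal mode: γ b = L_V b with γ ≥ 0, b smooth
divergence-free, b, ∇b ∈ L², |y| b ∈ L² forces b ≡ 0. Proof: γ‖b‖² = −ν‖∇b‖² + ∫ b·(b·∇)U −
(a/2)‖b‖² ≤ (C₀²/(4ν) − a/2)‖b‖² < 0 unless b = 0 (move the derivative onto b, Cauchy–Schwarz;
boundary terms vanish along a common sequence of spheres since |U||b|² + a|y||b|² + |b||∇b| ∈ L¹).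
In NS units (U = √(2a(T−t)) u) this is R_m = C₀²/(aν) < 2, the perturbative small-constant regime
(Leray1934 §20 lower bound ‖u(t)‖_∞ ≥ c√ν (T−t)^{-1/2}, in-tree leray_blowup_rate_top; ChaeWolf2017
Rmk 1.4). Role: calibration of the dictionary and seed of the definition request
kinematicHubbleThreshold C_kin(a,ν) := sup{C : no admissible V = U + a y with sup (1+|y|)|U| ≤ C
maintains a field}, whose certified lower bounds (optimal-kinematic-dynamo eigenvalue computations,
then interval arithmetic) are Type-I(C) Liouville theorems t -/
@[route_item "route-NavierStokesRegularity-HubbleDynamo"]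
def BackusRung : Prop :=
  ∀ (ν a C₀ γ : ℝ), 0 < ν → 0 < a → C₀ ^ 2 < 2 * a * ν → 0 ≤ γ → ∀ (U b : EuclideanSpace ℝ (Fin 3) → EuclideanSpace ℝ (Fin 3)), ContDiff ℝ (⊤ : ℕ∞) U → Literature.Analysis.FluidPDE.VectorCalculus.IsDivFree U → (∀ y, ‖U y‖ ≤ C₀) → (∃ C₁ : ℝ, ∀ y, ‖fderiv ℝ U y‖ ≤ C₁) → ContDiff ℝ (⊤ : ℕ∞) b → Literature.Analysis.FluidPDE.VectorCalculus.IsDivFree b → MeasureTheory.MemLp b 2 MeasureTheory.volume → MeasureTheory.MemLp (fun y => fderiv ℝ b y) 2 MeasureTheory.volume → MeasureTheory.Integrable (fun y => ‖y‖ ^ 2 * ‖b y‖ ^ 2) MeasureTheory.volume → (∀ y, γ • b y = ν • Laplacian.laplacian b y + Literature.Analysis.FluidPDE.curl (fun z => Literature.Analysis.FluidPDE.cross (U z + a • z) (b z)) y) → b = 0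

-- `BackusRung` holds: proved by `Summit.NavierStokesRegularity.NavierStokesRegularity.Theorems.hubbleDynamo_backusRung_proof` @ 8723bd60c0b6 (its module imports this route file, so no `_holds` link can be stated here).

/-- item stmt-NavierStokesRegularity-2060 · support · rank 9 · closed · proved by Summit.NavierStokesRegularity.NavierStokesRegularity.Theorems.hubbleDynamo_helicityFluxIdentity_proof (prover) · by planner
[support] (rank 9; informal until the R → ∞ boundary term is justified in the Chae–Wolf decay class)
HELICITY-FLUX SOLVABILITY IDENTITY (card self-dynamo-hubble-flow (v)). With A = U (Coulomb gauge)
the magnetic helicity of the maintained field Ω = curl U is the PROFILE HELICITY ∫ U·Ω; it is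
ideally invariant under transport by ANY velocity V, in particular V = U + a y, and is destroyed
only by Ohmic loss −2ν ∫ Ω·curl Ω. For an s-periodic (λ-DSS) or steady Type-I profile in the
Chae–Wolf class (|∇^k U| ≤ C_k (1+|y|)^{-1-k}), integrating the helicity balance over one period on
balls B_R leaves a boundary flux that does NOT vanish as R → ∞ (each term scales like |U||Ω||V| R² ~
R^{-1}·R^{-2}·aR·R² = O(1)): claimed identity 2ν ∮∫_{ℝ³} Ω·curl Ω dy ds = −∮ F_∞[U₀](s) ds, where
F_∞ is an explicit helicity-flux functional (leading term a ∫_{S²} h_∞ dθ with h_∞ the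
(−3)-homogeneous tail of U·Ω, plus the companion (U·V)(Ω·n) terms) computable from the
(−1)-homogeneous tail U₀ ALONE, i.e. from the blow-up TRACE u(x,T) ~ U₀(x/|x|)/|x|. Reading: the
inviscid far field of a Type-I singularity must export exactly the superhelicity the viscous core
destroys; a NECESSARY CONDITION on profiles (cons -/
@[route_item "route-NavierStokesRegularity-HubbleDynamo"]
def HelicityFluxIdentity : Prop :=
  ∀ (ν a : ℝ) (U : EuclideanSpace ℝ (Fin 3) → EuclideanSpace ℝ (Fin 3)) (P : EuclideanSpace ℝ (Fin 3) → ℝ), ContDiff ℝ (⊤ : ℕ∞) U → ContDiff ℝ (⊤ : ℕ∞) P → Literature.Analysis.FluidPDE.IsLerayProfile ν a U P → (∃ C : ℝ, ∀ y, ‖U y‖ ≤ C / (1 + ‖y‖) ∧ ‖fderiv ℝ U y‖ ≤ C / (1 + ‖y‖) ^ 2 ∧ ‖fderiv ℝ (Literature.Analysis.FluidPDE.curl U) y‖ ≤ C / (1 + ‖y‖) ^ 3 ∧ |P y| ≤ C / (1 + ‖y‖)) → Filter.Tendsto (fun R : ℝ => a * ∫ y, fderiv ℝ (Literature.Analysis.FluidPDE.cutoff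 R) y y * inner ℝ (U y) (Literature.Analysis.FluidPDE.curl U y)) Filter.atTop (nhds (2 * ν * ∫ x, inner ℝ (Literature.Analysis.FluidPDE.curl U x) (Literature.Analysis.FluidPDE.curl (Literature.Analysis.FluidPDE.curl U) x)))

-- `HelicityFluxIdentity` holds: proved by `Summit.NavierStokesRegularity.NavierStokesRegularity.Theorems.hubbleDynamo_helicityFluxIdentity_proof` (its module imports this route file, so no `_holds` link can be stated here).

/-- item stmt-NavierStokesRegularity-1940 · assembly · rank 1 · closed · proved by Summit.NavierStokesRegularity.NavierStokesRegularity.Theorems.hubbleDynamo_assembly_proof (prover) · by planner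
sources: KochNadirashviliSereginSverak2009, Fefferman2000
[assembly] NoSelfExcitedDynamo → FarFieldSlaving → NoTypeII → NoBlowupToClay →
NavierStokesRegularity. PURE LOGIC given the zoom glue DynamoKillsTypeI (verified sorry-free in the
planner's Sketch.lean, theorem assembly_of_glue, 6 lines): fix ν, T, u, p as in NoBlowup; if u had
no smooth extension past T it is maximal, NoTypeII gives the Type-I rate, DynamoKillsTypeI (fed with
the first two hypotheses) gives an extension — contradiction; hence NoBlowup, and the fourth
hypothesis (= stmt-NavierStokesRegularity-0055) yields Clay (A). -/
@[route_item "route-NavierStokesRegularity-HubbleDynamo"]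
def Assembly : Prop :=
  (∀ u : ℝ → EuclideanSpace ℝ (Fin 3) → EuclideanSpace ℝ (Fin 3), Literature.Analysis.FluidPDE.IsBoundedAncientMildSolution 1 u → (∀ t < 0, MeasureTheory.AEStronglyMeasurable (u t) MeasureTheory.volume) → (∃ C : ℝ, Literature.Analysis.FluidPDE.HasTypeIDecay C u) → ∀ t < 0, u t =ᵐ[MeasureTheory.volume] 0) → (∀ (ν T : ℝ), 0 < ν → 0 < T → ∀ (u : ℝ → EuclideanSpace ℝ (Fin 3) → EuclideanSpace ℝ (Fin 3)) (p : ℝ → EuclideanSpace ℝ (Fin 3) → ℝ), Literature.Analysis.FluidPDE.IsClassicalNSSolutionOn (Set.Ico 0 T) ν 0 u p → Literature.Analysis.FluidPDE.IsLerayHopfOn T ν 0 (u 0) u → Literature.Analysis.FluidPDE.HasRapidSpatialDecay (u 0) → Literature.Analysis.FluidPDE.IsTypeIBlowup u T → ∀ x₀ : EuclideanSpace ℝ (Fin 3), ∃ δ : ℝ, 0 < δ ∧ ∃ C : ℝ, ∀ t ∈ Set.Ioo (T - δ ^ 2) T, ∀ x ∈ Metric.ball x₀ δ, ‖u t x‖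 ≤ C / (‖x - x₀‖ + Real.sqrt (T - t))) → (∀ (ν T : ℝ), 0 < ν → 0 < T → ∀ (u : ℝ → EuclideanSpace ℝ (Fin 3) → EuclideanSpace ℝ (Fin 3)) (p : ℝ → EuclideanSpace ℝ (Fin 3) → ℝ), Literature.Analysis.FluidPDE.IsMaximalSmoothSolution ν 0 u p T → Literature.Analysis.FluidPDE.IsLerayHopfOn T ν 0 (u 0) u → Literature.Analysis.FluidPDE.HasRapidSpatialDecay (u 0) → Literature.Analysis.FluidPDE.IsTypeIBlowup u T) → ((∀ (ν T : ℝ), 0 < ν → 0 < T → ∀ (u : ℝ → EuclideanSpace ℝ (Fin 3) → EuclideanSpace ℝ (Fin 3)) (p : ℝ → EuclideanSpace ℝ (Fin 3) → ℝ), Literature.Analysis.FluidPDE.IsClassicalNSSolutionOn (Set.Ico 0 T) ν 0 u p → Literature.Analysis.FluidPDE.IsLerayHopfOn T ν 0 (u 0) u → Literature.Analysis.FluidPDE.HasRapidSpatialDecay (u 0) → Literature.Analysis.FluidPDE.HasSmoothExtensionPast ν 0 u T) → NavierStokesRegularity) → NavierStokesRegularity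

/-- `Assembly` holds: proved by `Summit.NavierStokesRegularity.NavierStokesRegularity.Theorems.hubbleDynamo_assembly_proof`. -/
theorem Assembly_holds : Assembly := _root_.Summit.NavierStokesRegularity.NavierStokesRegularity.Theorems.hubbleDynamo_assembly_proof

/-! D-0027 §2.1 — DECIDING THEOREM (planner-authored via `route open/edit --closes-file`; by planner-rbadge-NavierStokesRegularity-HubbleDy-98c4242a-g2-0 2026-08-15T16:10:13Z):
its hypotheses are this route's items and its conclusion the sub-problem Statement (glue_lint), and it elaborates with this file. -/

@[closes "route-NavierStokesRegularity-HubbleDynamo"] theorem closes (h₁ : NoSelfExcitedDynamo) (h₂ : FarFieldSlaving) (h₃ : NoTypeII) (h₄ : NoBlowupToClay) (h₅ : DynamoKillsTypeI) : _root_.NavierStokesRegularity := by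
  apply h₄
  intro ν T hν hT u p hcl hLH hdec
  by_contra hext
  exact hext (h₅ h₁ h₂ ν T hν hT u p hcl hLH hdec (h₃ ν T hν hT u p ⟨hcl, hext⟩ hLH hdec))

end Summit.NavierStokesRegularity.NavierStokesRegularity.Theses.HubbleDynamo
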